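import Summits.Ventures.Crystal3D.Theorems.StickyWulffConstantCoaxialWallLawPlateFoot
import Summits.Ventures.Crystal3D.Theorems.StickyWulffConstantGenericWallFloorShellCount
import HarnessLib

/-!
# Counting tools for the thin-wall law: tilt of a foreign plate, height of located exits, fibres of the foot map

HONEST FRAMING. Part of the venture `Summits/Ventures/Crystal3D` (cell `crystal3d-full`), helper
`--supports` the crux `CoaxialWallLaw` (stmt-Ventures-19481, `route-Ventures-StickyWulffConstant`),
REGISTERED line `WallLedgerF` (planner cf-p1 gen 16), stub `stub_coaxialTwoSlabAdhesion`.  Three small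
inputs of the residual-free THIN-WALL form of the co-axial general-filling law (next file): every
foreign-twin-capped in-plane exit is paid by an unsaturated ball `O(1+h)` steps down its plate
(`twinDozen_plateFoot_payer`), and the map exit ↦ foot has fibres `O(1+h)`.  Rung credit only; F-C1 not moved.

* `sqrt_two_thirds_le_tilt_add` — if a unit vector `v` is in-plane for the axis `m` (`⟪v, m⟫ = 0`) and is a
  far slot of the unit normal `n` (`⟪v, n⟫ = √(2/3)`), then `√(2/3) ≤ √(1 − ⟪n,e₃⟫²) + √(1 − ⟪m,e₃⟫²)`: a
  foreign plate met along an in-plane line of a vicinal wall (`sin θ ≤ 2/5`) is far from horizontal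
  (`√(1 − ⟪n,e₃⟫²) ≥ √(2/3) − 2/5`, so the descent rate of `exists_descent_farDiff` is `≥ 1/3`).
* `located_exit_height_gt` — a located exit of a non-descending slot (off the `(ρ−3)`-rim) lies above
  `−R₀ − 3` (contrapositive of `slot_mem_of_full_shell_bottom_of_nonneg_sealed`).
* `card_le_of_foot_map` — if every element of `E` is `y − k·A(uᵢ − uⱼ)` for a ball `y` of `X` within contact
  distance one of some `z ∈ Z`, `k ≤ K` and slots `uᵢ, uⱼ`, then `#E ≤ 1872 (K+1) · #Z`
  (`13` balls within contact distance one, `144` slot pairs).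

WHAT THIS IS NOT: not the stub; F-C1 not moved.
-/

noncomputable section

namespace Summit.Ventures.Crystal3D.Theorems

open Summit.Ventures.Crystal3D Finset
open Literature.MathematicalPhysics.StatisticalMechanics (fccStacking)
open scoped InnerProductSpace

/-- The component of a unit vector `v` along `e₃` is at most `√(1 − ⟪m,e₃⟫²)` when `v ⊥ m` (`m` unit). -/
theorem abs_inner_e₃_le_tilt {v m : EuclideanSpace ℝ (Fin 3)} (hv : ‖v‖ = 1) (hm : ‖m‖ = 1)
    (hvm : ⟪v, m⟫_ℝ = 0) :
    |⟪v, EuclideanSpace.single (2 : Fin 3) (1 : ℝ)⟫_ℝ| ≤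
      Real.sqrt (1 - ⟪m, EuclideanSpace.single (2 : Fin 3) (1 : ℝ)⟫_ℝ ^ 2) := by
  set e₃ : EuclideanSpace ℝ (Fin 3) := EuclideanSpace.single (2 : Fin 3) (1 : ℝ) with he₃
  have he₃n : ‖e₃‖ = 1 := by rw [he₃, PiLp.norm_single, norm_one]
  set g : EuclideanSpace ℝ (Fin 3) := e₃ - ⟪m, e₃⟫_ℝ • m with hg
  have h1 : ⟪v, e₃⟫_ℝ = ⟪v, g⟫_ℝ := by
    rw [hg, inner_sub_right, real_inner_smul_right, hvm, mul_zero, sub_zero]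
  have hgg : ⟪g, g⟫_ℝ = 1 - ⟪m, e₃⟫_ℝ ^ 2 := by
    have mm : ⟪m, m⟫_ℝ = 1 := by rw [real_inner_self_eq_norm_sq, hm, one_pow]
    have ee : ⟪e₃, e₃⟫_ℝ = 1 := by rw [real_inner_self_eq_norm_sq, he₃n, one_pow]
    rw [hg]
    simp only [inner_sub_left, inner_sub_right, real_inner_smul_left, real_inner_smul_right]
    rw [ee, mm, real_inner_comm e₃ m]; ring
  have hgn : ‖g‖ = Real.sqrt (1 - ⟪m, e₃⟫_ℝ ^ 2) := by
    rw [← hgg, real_inner_self_eq_norm_sq g, Real.sqrt_sq (norm_nonneg _)]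
  rw [h1, ← hgn]
  have := abs_real_inner_le_norm v g
  rw [hv, one_mul] at this
  exact this

/-- **A foreign plate met along an in-plane line is tilted.**  See the module docstring. -/
theorem sqrt_two_thirds_le_tilt_add {v m n : EuclideanSpace ℝ (Fin 3)} (hv : ‖v‖ = 1) (hm : ‖m‖ = 1)
    (hn : ‖n‖ = 1) (hvm : ⟪v, m⟫_ℝ = 0) (hvn : ⟪v, n⟫_ℝ = Real.sqrt (2 / 3)) :
    Real.sqrt (2 / 3) ≤ Real.sqrt (1 - ⟪n, EuclideanSpace.single (2 : Fin 3) (1 : ℝ)⟫_ℝ ^ 2) +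
      Real.sqrt (1 - ⟪m, EuclideanSpace.single (2 : Fin 3) (1 : ℝ)⟫_ℝ ^ 2) := by
  set e₃ : EuclideanSpace ℝ (Fin 3) := EuclideanSpace.single (2 : Fin 3) (1 : ℝ) with he₃
  have he₃n : ‖e₃‖ = 1 := by rw [he₃, PiLp.norm_single, norm_one]
  have hvm' := abs_inner_e₃_le_tilt hv hm hvm
  -- `⟪v, n⟫ = ⟪v, n − ⟪n,e₃⟫ e₃⟫ + ⟪n,e₃⟫ ⟪v,e₃⟫`
  set g : EuclideanSpace ℝ (Fin 3) := n - ⟪n, e₃⟫_ℝ • e₃ with hg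
  have h1 : ⟪v, n⟫_ℝ = ⟪v, g⟫_ℝ + ⟪n, e₃⟫_ℝ * ⟪v, e₃⟫_ℝ := by
    rw [hg, inner_sub_right, real_inner_smul_right]; ring
  have hgg : ⟪g, g⟫_ℝ = 1 - ⟪n, e₃⟫_ℝ ^ 2 := by
    have nn : ⟪n, n⟫_ℝ = 1 := by rw [real_inner_self_eq_norm_sq, hn, one_pow]
    have ee : ⟪e₃, e₃⟫_ℝ = 1 := by rw [real_inner_self_eq_norm_sq, he₃n, one_pow]
    rw [hg]
    simp only [inner_sub_left, inner_sub_right, real_inner_smul_left, real_inner_smul_right]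
    rw [ee, nn, real_inner_comm e₃ n]; ring
  have hgn : ‖g‖ = Real.sqrt (1 - ⟪n, e₃⟫_ℝ ^ 2) := by
    rw [← hgg, real_inner_self_eq_norm_sq g, Real.sqrt_sq (norm_nonneg _)]
  have h2 : ⟪v, g⟫_ℝ ≤ Real.sqrt (1 - ⟪n, e₃⟫_ℝ ^ 2) := by
    have := abs_real_inner_le_norm v g
    rw [hv, one_mul, hgn] at this
    exact (le_abs_self _).trans this
  have h3 : ⟪n, e₃⟫_ℝ * ⟪v, e₃⟫_ℝ ≤ Real.sqrt (1 - ⟪m, e₃⟫_ℝ ^ 2) := by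
    have hne : |⟪n, e₃⟫_ℝ| ≤ 1 := by
      have := abs_real_inner_le_norm n e₃; rwa [hn, he₃n, one_mul] at this
    have := abs_mul ⟪n, e₃⟫_ℝ ⟪v, e₃⟫_ℝ
    have h4 : |⟪n, e₃⟫_ℝ| * |⟪v, e₃⟫_ℝ| ≤ 1 * Real.sqrt (1 - ⟪m, e₃⟫_ℝ ^ 2) :=
      mul_le_mul hne hvm' (abs_nonneg _) zero_le_one
    rw [one_mul] at h4
    exact (le_abs_self _).trans (this ▸ h4)
  rw [← hvn, h1]; linarith

/-- **Located exits are above `−R₀ − 3`.**  In the sealed bottom-sample cell, a `u`-exit `e` of the grain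
along a NON-DESCENDING slot `u`, off the `(ρ − 3)`-rim, has height `> −R₀ − 3`. -/
theorem located_exit_height_gt
    (A : EuclideanSpace ℝ (Fin 3) ≃ₗᵢ[ℝ] EuclideanSpace ℝ (Fin 3)) (t : EuclideanSpace ℝ (Fin 3))
    (X P : Finset (EuclideanSpace ℝ (Fin 3))) (R₀ ρ : ℝ) (hR₀ : 3 ≤ R₀) (hρ : R₀ ≤ ρ)
    (hX : ∀ p ∈ X, ∀ q ∈ X, p ≠ q → 1 ≤ dist p q) (hPX : P ⊆ X)
    (hcell : ∀ p ∈ X, -(2 * R₀) ≤ p 2)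
    (hP : ∀ p, p ∈ P ↔ (p ∈ (fun q => A q + t) '' fccStacking 1 (Real.sqrt (2 / 3)) ∧
      -(2 * R₀) ≤ p 2 ∧ p 2 ≤ -R₀ ∧ p 0 ^ 2 + p 1 ^ 2 ≤ ρ ^ 2))
    {u : EuclideanSpace ℝ (Fin 3)} (hu : u ∈ fccSlots)
    (hup : 0 ≤ ⟪A u, EuclideanSpace.single (2 : Fin 3) (1 : ℝ)⟫_ℝ)
    {e : EuclideanSpace ℝ (Fin 3)} (hd : e - A u ∈ X) (hfull : ∀ w ∈ fccSlots, e - A u + A w ∈ X)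
    (hlack : ∃ v ∈ fccSlots, e + A v ∉ X) (her : e 0 ^ 2 + e 1 ^ 2 ≤ (ρ - 3) ^ 2) :
    -R₀ - 3 < e 2 := by
  by_contra hle
  push Not at hle
  obtain ⟨v, hv, hev⟩ := hlack
  have hAu : ‖A u‖ = 1 := by rw [LinearIsometryEquiv.norm_map, norm_eq_one_of_mem_fccSlots hu]
  have hd2 : (e - A u) 2 ≤ -R₀ - 3 := by
    have : (e - A u) 2 = e 2 - ⟪A u, EuclideanSpace.single (2 : Fin 3) (1 : ℝ)⟫_ℝ := by
      rw [PiLp.sub_apply, apply_two_eq_inner_e₃ (A u)]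
    rw [this]; linarith
  have hdr : (e - A u) 0 ^ 2 + (e - A u) 1 ^ 2 ≤ (ρ - 2) ^ 2 := by
    have h0 : (0 : ℝ) ≤ ρ - 3 := by linarith
    have := lateral_sq_add_le e (-(A u)) h0 her
    rw [norm_neg, hAu, ← sub_eq_add_neg, show ρ - 3 + 1 = ρ - 2 by ring] at this
    exact this
  have hmem := slot_mem_of_full_shell_bottom_of_nonneg_sealed A t X P R₀ ρ hR₀ hρ hX hPX hcell hP hd hfull hd2 hdr
    hu hup hv
  rw [sub_add_cancel] at hmem
  exact hev hmem

open scoped Classical in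
/-- At most thirteen balls of a `1`-separated configuration are within contact distance one of a point
(the point itself, if a ball, and its at most twelve contacts). -/
theorem card_filter_eq_or_dist_le_thirteen (X : Finset (EuclideanSpace ℝ (Fin 3)))
    (hX : ∀ p ∈ X, ∀ q ∈ X, p ≠ q → 1 ≤ dist p q) (z : EuclideanSpace ℝ (Fin 3)) :
    (X.filter fun y => z = y ∨ dist y z = 1).card ≤ 13 := by
  have hsub : (X.filter fun y => z = y ∨ dist y z = 1) ⊆ insert z (X.filter fun q => dist z q = 1) := by
    intro y hy
    rw [mem_filter] at hy
    rw [mem_insert]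
    rcases hy.2 with h | h
    · exact Or.inl h.symm
    · exact Or.inr (mem_filter.2 ⟨hy.1, by rw [dist_comm]; exact h⟩)
  calc (X.filter fun y => z = y ∨ dist y z = 1).card
      ≤ (insert z (X.filter fun q => dist z q = 1)).card := card_le_card hsub
    _ ≤ (X.filter fun q => dist z q = 1).card + 1 := card_insert_le _ _
    _ ≤ 12 + 1 := by have := card_filter_dist_eq_one_le_twelve X hX z; omega
    _ = 13 := by norm_num

open scoped Classical in
/-- **Fibres of the foot map.**  See the module docstring. -/
theorem card_le_of_foot_map (A : EuclideanSpace ℝ (Fin 3) ≃ₗᵢ[ℝ] EuclideanSpace ℝ (Fin 3))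
    (X E Z : Finset (EuclideanSpace ℝ (Fin 3))) (hX : ∀ p ∈ X, ∀ q ∈ X, p ≠ q → 1 ≤ dist p q) (K : ℕ)
    (hE : ∀ e ∈ E, ∃ z ∈ Z, ∃ uᵢ ∈ fccSlots, ∃ uⱼ ∈ fccSlots, ∃ k : ℕ, k ≤ K ∧
      (e + (k : ℝ) • A (uᵢ - uⱼ)) ∈ X ∧
      (z = e + (k : ℝ) • A (uᵢ - uⱼ) ∨ dist (e + (k : ℝ) • A (uᵢ - uⱼ)) z = 1)) :
    E.card ≤ 1872 * (K + 1) * Z.card := by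
  -- the candidate set attached to a foot `z`
  set F : EuclideanSpace ℝ (Fin 3) → Finset (EuclideanSpace ℝ (Fin 3)) := fun z =>
    (((X.filter fun y => z = y ∨ dist y z = 1) ×ˢ (range (K + 1) ×ˢ (fccSlots ×ˢ fccSlots))).image
      fun p => p.1 - (p.2.1 : ℝ) • A (p.2.2.1 - p.2.2.2)) with hF
  have hsub : E ⊆ Z.biUnion F := by
    intro e he
    obtain ⟨z, hz, uᵢ, hi, uⱼ, hj, k, hk, hyX, hyz⟩ := hE e he
    rw [mem_biUnion]
    refine ⟨z, hz, ?_⟩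
    rw [hF, mem_image]
    refine ⟨(e + (k : ℝ) • A (uᵢ - uⱼ), (k, (uᵢ, uⱼ))), ?_, ?_⟩
    · rw [mem_product, mem_product, mem_product, mem_filter, mem_range]
      exact ⟨⟨hyX, hyz⟩, Nat.lt_succ_of_le hk, hi, hj⟩
    · simp only [add_sub_cancel_right]
  have hFcard : ∀ z, (F z).card ≤ 1872 * (K + 1) := by
    intro z
    rw [hF]
    refine card_image_le.trans ?_
    rw [card_product, card_product, card_product, card_range, card_fccSlots]
    have h13 := card_filter_eq_or_dist_le_thirteen X hX z
    calc (X.filter fun y => z = y ∨ dist y z = 1).card * ((K + 1) * (12 * 12))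
        ≤ 13 * ((K + 1) * (12 * 12)) := Nat.mul_le_mul_right _ h13
      _ = 1872 * (K + 1) := by ring
  calc E.card ≤ (Z.biUnion F).card := card_le_card hsub
    _ ≤ ∑ z ∈ Z, (F z).card := card_biUnion_le
    _ ≤ ∑ _z ∈ Z, 1872 * (K + 1) := sum_le_sum fun z _ => hFcard z
    _ = 1872 * (K + 1) * Z.card := by rw [sum_const, smul_eq_mul]; ring

end Summit.Ventures.Crystal3D.Theorems

end
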